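/-
[OURS · L1 W4.5(b) · EL♮(3)] SPECIMEN-Q DOWNSTAIRS — part R (transport of chart data along a blow-up chain).
[claim: Hironaka2017, status: under-review]
-/
import Summits.ResolutionOfSingularities.ResolutionOfSingularities.Theorems.EquisingularLiftEquisingularLiftNatSpecimenQuarticTcDeltaStage
import Literature.AlgebraicGeometry.Resolution.AlterationsNormalFormBlowupParts
import Literature.AlgebraicGeometry.Resolution.AlterationsSemiStableCodimTwoBlowupFibres

/-!
# [OURS · L1 W4.5(b) · EL♮(3)] SPECIMEN-Q DOWNSTAIRS, part R — TRANSPORT OF CHART DATA ALONG MORPHISMS THAT ARE ISOMORPHISMS OVER THE CHART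
# (crux `EquisingularLiftNatThree` = stmt-ResolutionOfSingularities-20148, line `sections3`; res-L1-w45b-lead-2 CUT 2026-08-27T08:41:07Z
# «SPECIMEN-Q DOWNSTAIRS» to res-D-pv-034 AS res-L1-s36-pv-3; helper, closes nothing)

HONEST FRAMING. OURS (cell `res-hironaka`, chain w45b, slot W4.5(b)); NOT a statement of any manuscript; AI-written, weaker than
expert review.

After the first (TC) step at `[0:0:0:1]` the second singular point `[1:0:0:0]` of the quartic lives on the blown-up ambient `F₃`, where
`σ = υ₁′ ≫ υ₁ : F₃ → ℙ³` is an isomorphism over the chart `D₊(x₀) = u0(Spec k[X])`. This file transports the chart data of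
`…TcDeltaStage` along such a `σ`:

* generic chart-point lemmas for an open immersion `w : Spec k[X] → F` into ANY scheme (`comap_vanishingIdeal_singleton_chart`,
  `isRegularLocalRing_stalk_chart`, `not_isRegularLocalRing_subscheme_of_chart` — the last via the tree's
  `isRegularLocalRing_localization_quotient_of_chart` and stub-4's `not_isRegularLocalRing_origin`);
* the topological bookkeeping of strict transforms over an open set avoiding the centres (`closure_inter_eq_of_isOpen`,
  `strictTransform_inter_preimage_eq`) and their irreducibility (`isIrreducible_strictTransform_of_isBlowup`);
* the lifted chart `liftChart σ u : Spec k[X] → F` for `[IsIso (σ ∣_ u.opensRange)]` with `liftChart ≫ σ = u`, its range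
  `σ⁻¹(u(Spec k[X]))`, the fibre `σ⁻¹{u(o)} = {liftChart(o)}`, and the pull-back identities
  `𝓘_{σ⁻¹…} · 𝒪 = 𝓘_… · 𝒪` (`comap_liftChart_of_inter_eq`).

References: Hartshorne II Ex. 3.2.6, Prop. 7.16; Stacks 0804, 080E; de Jong 1996 §4 (isomorphism off the centre), via the cited tree files.
-/

set_option linter.dupNamespace false -- mandated namespace `Summit.<Summit>.<Problem>` of this single-conjunct summit

noncomputable section

open CategoryTheory CategoryTheory.Limits AlgebraicGeometry TopologicalSpace
open MvPolynomial
open AlgebraicGeometry.Scheme.IdealSheafData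
open Literature.AlgebraicGeometry.Resolution
open Summit.ResolutionOfSingularities.ResolutionOfSingularities.Theorems.EquisingularLift

namespace Summit.ResolutionOfSingularities.ResolutionOfSingularities.Cruxes.EquisingularLiftNat.Sections

namespace SpecimenQuarticTcDelta

variable (k : Type) [Field k]

/-! ## Chart points in an arbitrary ambient scheme -/

section ChartPoint

variable {k}
variable {F : Scheme.{0}} (w : Spec (CommRingCat.of (MvPolynomial (Fin 3) k)) ⟶ F) [IsOpenImmersion w]

/-- `w⁻¹{w(o)} = {o}`. [folklore] -/
theorem preimage_singleton_chart : w ⁻¹' {w (o k)} = {o k} := by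
  ext q
  simp only [Set.mem_preimage, Set.mem_singleton_iff]
  exact w.isOpenEmbedding.injective.eq_iff

/-- **`𝓘_{w(o)} · 𝒪 = 𝔪₀~`** on an open-immersion chart `w` into any scheme. [folklore] -/
theorem comap_vanishingIdeal_singleton_chart (hc : IsClosed ({w (o k)} : Set F)) :
    (vanishingIdeal (⟨{w (o k)}, hc⟩ : Closeds F)).comap w =
      ofIdealTop ((PointBlowup.originIdeal 2 k).map (Scheme.ΓSpecIso (CommRingCat.of (MvPolynomial (Fin 3) k))).inv.hom) := by
  rw [comap_vanishingIdeal_of_isOpenImmersion]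
  have h : (Closeds.preimage (⟨{w (o k)}, hc⟩ : Closeds F) w.continuous) =
      ⟨PrimeSpectrum.zeroLocus (PointBlowup.originIdeal 2 k : Set (MvPolynomial (Fin 3) k)), PrimeSpectrum.isClosed_zeroLocus _⟩ :=
    Closeds.ext ((preimage_singleton_chart w).trans (singleton_o_eq_zeroLocus k))
  rw [h]
  have h2 := vanishingIdeal_zeroLocus_Spec (CommRingCat.of (MvPolynomial (Fin 3) k))
    (PointBlowup.originIdeal 2 k : Set (MvPolynomial (Fin 3) k))
  rw [Ideal.span_eq, (isMaximal_originIdeal k).isPrime.radical] at h2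
  exact h2

/-- The ambient is regular at a chart point. [folklore] -/
theorem isRegularLocalRing_stalk_chart : IsRegularLocalRing (F.presheaf.stalk (w (o k))) := by
  haveI : IsRegularLocalRing ((Spec (CommRingCat.of (MvPolynomial (Fin 3) k))).presheaf.stalk (o k)) :=
    Scheme.isRegular_Spec (CommRingCat.of (MvPolynomial (Fin 3) k)) (o k)
  exact IsRegularLocalRing.of_ringEquiv (asIso (w.stalkMap (o k))).commRingCatIsoToRingEquiv.symm

omit [IsOpenImmersion w] in
/-- A point of `V(closure T)_red` over `w(o)` when `w(o) ∈ T`. [folklore] -/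
theorem exists_point_subscheme_of_mem {T : Set F} (hmem : w (o k) ∈ T) :
    ∃ x : (vanishingIdeal (⟨closure T, isClosed_closure⟩ : Closeds F)).subscheme,
      (vanishingIdeal (⟨closure T, isClosed_closure⟩ : Closeds F)).subschemeι x = w (o k) := by
  have h : w (o k) ∈ Set.range (vanishingIdeal (⟨closure T, isClosed_closure⟩ : Closeds F)).subschemeι := by
    rw [range_subschemeι, Scheme.IdealSheafData.coe_support_vanishingIdeal]
    exact subset_closure hmem
  exact h

/-- **`V(closure T)_red` is NOT regular over `w(o)`** when `T` is closed irreducible with `𝓘_T · 𝒪 = (z² + x⁴ + y⁴)~` on the chart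
(any field `k`): a regular stalk would make `k[x,y,z]_{𝔪₀}/(z² + x⁴ + y⁴)` regular. [OURS · (TC) input «x non-regular»]
[cite: Matsumura1987, Thm. 14.2] -/
theorem not_isRegularLocalRing_subscheme_of_chart
    {T : Set F} (hTc : IsClosed T) (hTirr : IsIrreducible T)
    (hwT : (vanishingIdeal (⟨T, hTc⟩ : Closeds F)).comap w =
      ofIdealTop ((Ideal.span {(X 2 ^ 2 + X 0 ^ 4 + X 1 ^ 4 : MvPolynomial (Fin 3) k)}).map
        (Scheme.ΓSpecIso (CommRingCat.of (MvPolynomial (Fin 3) k))).inv.hom))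
    (x : (vanishingIdeal (⟨closure T, isClosed_closure⟩ : Closeds F)).subscheme)
    (hx : (vanishingIdeal (⟨closure T, isClosed_closure⟩ : Closeds F)).subschemeι x = w (o k)) :
    ¬ IsRegularLocalRing ((vanishingIdeal (⟨closure T, isClosed_closure⟩ : Closeds F)).subscheme.presheaf.stalk x) := by
  intro hreg
  haveI : IsIntegral (vanishingIdeal (⟨closure T, isClosed_closure⟩ : Closeds F)).subscheme :=
    ComponentGluing.isIntegral_subscheme_vanishingIdeal _ (by
      change IsIrreducible (closure T)
      exact hTirr.closure)
  have hcl : (⟨closure T, isClosed_closure⟩ : Closeds F) = ⟨T, hTc⟩ := Closeds.ext hTc.closure_eq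
  have hIc : (vanishingIdeal (⟨closure T, isClosed_closure⟩ : Closeds F)).subschemeι.ker.comap w =
      affineBlowup.idealSheaf (Ideal.span {(X 2 ^ 2 + X 0 ^ 4 + X 1 ^ 4 : MvPolynomial (Fin 3) k)}) := by
    rw [ker_subschemeι, hcl, hwT]
    rfl
  letI := SpecimenQuartic.isPrime_origin k
  have h := isRegularLocalRing_localization_quotient_of_chart
    (vanishingIdeal (⟨closure T, isClosed_closure⟩ : Closeds F)).subschemeι w
    (Ideal.span {(X 2 ^ 2 + X 0 ^ 4 + X 1 ^ 4 : MvPolynomial (Fin 3) k)}) hIc (PointBlowup.originIdeal 2 k)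
    (by rw [Ideal.span_le, Set.singleton_subset_iff]; exact fQ_mem_originIdeal k) hx hreg
  rw [Ideal.map_span, Set.image_singleton] at h
  exact SpecimenQuartic.not_isRegularLocalRing_origin k h

end ChartPoint

/-! ## Strict transforms over an open set off the centres -/

section StrictTransform

variable {k}

/-- If `S ∩ O = C ∩ O` with `O` open and `C` closed, then `closure S ∩ O = C ∩ O`. [folklore] -/
theorem closure_inter_eq_of_isOpen {α : Type*} [TopologicalSpace α] {S O C : Set α} (hO : IsOpen O) (hC : IsClosed C)
    (h : S ∩ O = C ∩ O) : closure S ∩ O = C ∩ O := by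
  apply Set.Subset.antisymm
  · intro a ha
    have h1 : a ∈ closure (O ∩ S) := hO.inter_closure ⟨ha.2, ha.1⟩
    rw [Set.inter_comm, h] at h1
    exact ⟨hC.closure_subset_iff.mpr Set.inter_subset_left h1, ha.2⟩
  · rw [← h]
    exact Set.inter_subset_inter_left _ subset_closure

/-- **Strict transforms over an open set off the centre.** If `T ∩ O = S ∩ O` downstairs (`S` closed, `O` open) and the centre `C`
misses `O`, then `closure (υ⁻¹(T ∖ C)) ∩ υ⁻¹O = υ⁻¹S ∩ υ⁻¹O`. [folklore] -/
theorem strictTransform_inter_preimage_eq {F₁ F₂ : Scheme.{0}} (υ : F₂ ⟶ F₁) {T S O C : Set F₁} (hO : IsOpen O)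
    (hS : IsClosed S) (h : T ∩ O = S ∩ O) (hC : C ∩ O = ∅) :
    closure (υ ⁻¹' (T \ C)) ∩ υ ⁻¹' O = υ ⁻¹' S ∩ υ ⁻¹' O := by
  apply closure_inter_eq_of_isOpen (hO.preimage υ.continuous) (hS.preimage υ.continuous)
  rw [← Set.preimage_inter, ← Set.preimage_inter]
  congr 1
  ext a
  constructor
  · rintro ⟨⟨haT, -⟩, haO⟩
    exact ⟨(h.le ⟨haT, haO⟩).1, haO⟩
  · rintro ⟨haS, haO⟩
    refine ⟨⟨(h.ge ⟨haS, haO⟩).1, fun haC => ?_⟩, haO⟩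
    have : a ∈ C ∩ O := ⟨haC, haO⟩
    rw [hC] at this
    exact this

/-- **Irreducibility of a strict transform**: for a blow-up `υ` of `F₁` along `V(C)_red` (`C` closed) and `T` irreducible with
`T ⊄ C`, `closure (υ⁻¹(T ∖ C))` is irreducible. [cite: DeJong1996, 4.26] [folklore] -/
theorem isIrreducible_strictTransform_of_isBlowup {F₁ F₂ : Scheme.{0}} {υ : F₂ ⟶ F₁} (C : Closeds F₁)
    (hυ : IsBlowup υ (vanishingIdeal C)) {T : Set F₁} (hT : IsIrreducible T) (hTC : ¬ T ⊆ C) :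
    IsIrreducible (closure (υ ⁻¹' (T \ C))) := by
  haveI : IsIso (υ ∣_ ⟨(C : Set F₁)ᶜ, C.isClosed.isOpen_compl⟩) :=
    hυ.isIso_morphismRestrict (by
      rw [Scheme.IdealSheafData.coe_support_vanishingIdeal]
      exact disjoint_compl_left)
  refine IsIrreducible.closure ?_
  refine isIrreducible_preimage_of_isIso_morphismRestrict υ ⟨(C : Set F₁)ᶜ, C.isClosed.isOpen_compl⟩ ?_
    (Set.sdiff_subset_compl T _)
  have hne : (T \ (C : Set F₁)).Nonempty := by
    by_contra hc
    rw [Set.not_nonempty_iff_eq_empty, Set.sdiff_eq_empty] at hc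
    exact hTC hc
  rw [Set.sdiff_eq]
  exact ⟨Set.sdiff_eq (s := T) (t := (C : Set F₁)) ▸ hne, isPreirreducible_inter_of_isOpen hT.isPreirreducible C.isClosed.isOpen_compl⟩

end StrictTransform

/-! ## The lifted chart along a morphism that is an isomorphism over the chart -/

section LiftChart

variable {k}
variable {Y F : Scheme.{0}} (σ : F ⟶ Y) (u : Spec (CommRingCat.of (MvPolynomial (Fin 3) k)) ⟶ Y) [IsOpenImmersion u]
  [IsIso (σ ∣_ u.opensRange)]

/-- `Spec k[X] ≅ u(Spec k[X])` as schemes. [folklore] -/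
def chartIsoOpensRange : Spec (CommRingCat.of (MvPolynomial (Fin 3) k)) ≅ (u.opensRange : Y.Opens) :=
  IsOpenImmersion.isoOfRangeEq u u.opensRange.ι (by rw [Scheme.Opens.range_ι]; rfl)

/-- **The lifted chart** `Spec k[X] ≅ u(Spec k[X]) ≅ σ⁻¹(u(Spec k[X])) ⊆ F`. [folklore] -/
def liftChart : Spec (CommRingCat.of (MvPolynomial (Fin 3) k)) ⟶ F :=
  (chartIsoOpensRange u).hom ≫ inv (σ ∣_ u.opensRange) ≫ (σ ⁻¹ᵁ u.opensRange).ι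

/-- The lifted chart is an open immersion. [folklore] -/
instance isOpenImmersion_liftChart : IsOpenImmersion (liftChart σ u) := by
  unfold liftChart; infer_instance

/-- `liftChart ≫ σ = u`. [folklore] -/
theorem liftChart_comp : liftChart σ u ≫ σ = u := by
  rw [liftChart, Category.assoc, Category.assoc, ← morphismRestrict_ι, IsIso.inv_hom_id_assoc]
  exact IsOpenImmersion.isoOfRangeEq_hom_fac _ _ _

/-- `σ (liftChart q) = u q`. [folklore] -/
theorem σ_liftChart_apply (q : Spec (CommRingCat.of (MvPolynomial (Fin 3) k))) : σ (liftChart σ u q) = u q := by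
  rw [← Scheme.Hom.comp_apply, liftChart_comp]

/-- `range (liftChart) = σ⁻¹(range u)`. [folklore] -/
theorem range_liftChart : Set.range (liftChart σ u) = σ ⁻¹' Set.range u := by
  have hsurj : Function.Surjective ((chartIsoOpensRange u).hom ≫ inv (σ ∣_ u.opensRange)) :=
    (Scheme.homeoOfIso (asIso ((chartIsoOpensRange u).hom ≫ inv (σ ∣_ u.opensRange)))).surjective
  have h1 : Set.range (liftChart σ u) = Set.range (σ ⁻¹ᵁ u.opensRange).ι := by
    rw [liftChart, ← Category.assoc]
    change Set.range (fun q => (σ ⁻¹ᵁ u.opensRange).ι (((chartIsoOpensRange u).hom ≫ inv (σ ∣_ u.opensRange)) q)) = _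
    exact hsurj.range_comp _
  rw [h1, Scheme.Opens.range_ι]
  rfl

/-- The fibre of `σ` over a chart point is the lifted chart point: `σ⁻¹{u(o)} = {liftChart(o)}`. [folklore] -/
theorem preimage_σ_singleton : σ ⁻¹' {u (o k)} = {liftChart σ u (o k)} := by
  obtain ⟨z, hz⟩ := exists_preimage_singleton_eq_singleton_of_isIso_morphismRestrict σ u.opensRange
    (y := u (o k)) ⟨o k, rfl⟩
  have hmem : liftChart σ u (o k) ∈ σ ⁻¹' {u (o k)} := by
    change σ (liftChart σ u (o k)) ∈ ({u (o k)} : Set Y)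
    rw [σ_liftChart_apply]
    exact Set.mem_singleton _
  rw [hz] at hmem ⊢
  rw [Set.mem_singleton_iff.mp hmem]

/-- `{liftChart(o)}` is closed when `{u(o)}` is. [folklore] -/
theorem isClosed_singleton_liftChart (hc : IsClosed ({u (o k)} : Set Y)) : IsClosed ({liftChart σ u (o k)} : Set F) := by
  rw [← preimage_σ_singleton σ u]
  exact hc.preimage σ.continuous

/-- **Pull-backs along the lifted chart**: if `T ∩ σ⁻¹(range u) = σ⁻¹(S ∩ range u)` then `𝓘_T · 𝒪_{Spec k[X]}` (via `liftChart`)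
equals `𝓘_S · 𝒪_{Spec k[X]}` (via `u`). [folklore] -/
theorem comap_liftChart_of_inter_eq {T : Set F} (hT : IsClosed T) {S : Set Y} (hS : IsClosed S)
    (h : T ∩ σ ⁻¹' Set.range u = σ ⁻¹' (S ∩ Set.range u)) :
    (vanishingIdeal (⟨T, hT⟩ : Closeds F)).comap (liftChart σ u) = (vanishingIdeal (⟨S, hS⟩ : Closeds Y)).comap u := by
  rw [comap_vanishingIdeal_of_isOpenImmersion, comap_vanishingIdeal_of_isOpenImmersion]
  congr 1
  apply Closeds.ext
  change liftChart σ u ⁻¹' T = u ⁻¹' S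
  have h1 : liftChart σ u ⁻¹' T = liftChart σ u ⁻¹' (T ∩ σ ⁻¹' Set.range u) := by
    ext q
    simp only [Set.mem_preimage, Set.mem_inter_iff, Set.mem_range]
    constructor
    · intro hq
      exact ⟨hq, q, (σ_liftChart_apply σ u q).symm⟩
    · exact fun hq => hq.1
  rw [h1, h]
  ext q
  simp only [Set.mem_preimage, Set.mem_inter_iff, σ_liftChart_apply, Set.mem_range_self, and_true]

/-- Membership transport: `liftChart(o) ∈ T` when `u(o) ∈ S` and `T ∩ σ⁻¹(range u) = σ⁻¹(S ∩ range u)`. [folklore] -/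
theorem liftChart_o_mem {T : Set F} {S : Set Y} (h : T ∩ σ ⁻¹' Set.range u = σ ⁻¹' (S ∩ Set.range u)) (hS : u (o k) ∈ S) :
    liftChart σ u (o k) ∈ T := by
  have h1 : liftChart σ u (o k) ∈ σ ⁻¹' (S ∩ Set.range u) := by
    change σ (liftChart σ u (o k)) ∈ S ∩ Set.range u
    rw [σ_liftChart_apply]
    exact ⟨hS, o k, rfl⟩
  rw [← h] at h1
  exact h1.1

end LiftChart

end SpecimenQuarticTcDelta

end Summit.ResolutionOfSingularities.ResolutionOfSingularities.Cruxes.EquisingularLiftNat.Sections
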